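import Literature.AlgebraicGeometry.Motives.GrassmannianUniversalQuotient
import Literature.AlgebraicGeometry.Motives.GrassmannianChartTautologicalQuotient
import HarnessLib

/-!
# The universal chart data of the Grassmannian scheme and THE UNIVERSAL QUOTIENT

Topic `AlgebraicGeometry/Motives`; namespace `Literature.AlgebraicGeometry.Motives.Grassmannian`.  OBJECTS file (one `def` of a
structure instance + three `abbrev` specialisations, with `rfl`/plumbing lemmas); no instance, no notation, no named fact, no `sorry`.
Chart-side brick (c4) of the cell's (h4) (Q3) «universal quotient on `grassmannianScheme M k`» (lead B-p21 (g16)): his ★ generic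
construction `ChartData.quotientModule` (`GrassmannianUniversalQuotient`: the rank-`k` module glued from chart data of a point
`x ∈ Gr(T)` along the transition cocycle ★ `GrassmannianChartTransition`) is instantiated at THE UNIVERSAL POINT
`x₀ = pointsEquiv (𝟙 (grassmannianScheme M k))` with the standard open cover by the chart immersions (★ `GrassmannianSchemeOpenCover`):

* §1 `evalAffine_mem_chart_of_le_chartLocus` — for an affine open `V ≤ chartLocus x y`, the evaluation `y|_V` lies in the chart `x`
  (★ `map_mem_chartSubsheaf_iff` along `fromSpec : Spec Γ(T, V) → T`), and conversely (`le_chartLocus_of_evalAffine_mem_chart`);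
* §2 **`universalChartData k M b : ChartData b x₀ {I : Fin k → J // I injective}`** — `U_I = im(Spec ℤ[X_I] ⟶ Gr)` (affine, Mathlib
  `isAffineOpen_opensRange`), `U_I ∩ U_{I′}` affine (★ (B0) `isAffineOpen_opensRange_inf_opensRange`), frame `b ∘ I`, `x₀|_{U_I} ∈ chart`
  (★ `opensRange_chartι_eq` + §1); `exists_mem_universalChartData_U` (the `U_I` cover);
* §3 **`universalQuotient M k b := (universalChartData k M b).quotientModule`**, `universalQuotientπ : 𝒪^{(J)} ⟶ universalQuotient`,
  `universalQuotientSection j`, with `hasRank_universalQuotient : HasRank _ k` and `epi_universalQuotientπ` (★ G1 heads at the cover).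

[GortzWedhorn2020, (8.4) (pp. 213–215)] (the universal quotient `𝒪_{Grass} ⊗ M ↠ 𝒬`); [StacksProject, Tag 089R / 089T].  Cell `hodgecm-mathlib`
(D-0151), count-neutral Mathlib-side capital; nothing here is about HC — HC_CM is proved only modulo the 7 printed citations until rung 0 closes.
-/

noncomputable section
-- `TopCat.Presheaf`/`Scheme.Modules` are not reducible (as in Mathlib's `AlgebraicGeometry/Modules/Tilde.lean`).
set_option backward.isDefEq.respectTransparency false

namespace Literature.AlgebraicGeometry.Motives.Grassmannian

open CategoryTheory Opposite TensorProduct TopologicalSpace _root_.AlgebraicGeometry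
open Literature.AlgebraicGeometry.Modules

universe u

variable {k : ℕ} {M : Type u} [AddCommGroup M] {J : Type u}

/-! ## §1 Affine opens inside a chart locus -/

/-- **An affine open inside the chart locus evaluates into the chart**: for `y ∈ Gr(T)`, a frame `x` and an affine open
`V ≤ chartLocus x y`, `evalAffine V y ∈ chart ℤ M k x Γ(T, V)` (restrict `y` along `fromSpec_V : Spec Γ(T, V) → T`, whose image is
`V ⊆ chartLocus x y`, ★ `map_mem_chartSubsheaf_iff`, and read the chart subfunctor on `Spec` through `specEquiv`).
[cite: GortzWedhorn2020, (8.4), Lemma 8.13 (p. 215)] [cite: StacksProject, Tag 089T] -/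
theorem evalAffine_mem_chart_of_le_chartLocus (x : Fin k → M) {T : Scheme.{u}} (y : (grassmannianSheaf M k).obj.obj (op T))
    {V : T.Opens} (hV : IsAffineOpen V) (h : V ≤ chartLocus x y) : evalAffine hV y ∈ chart ℤ M k x Γ(T, V) := by
  have h1 : (grassmannianSheaf M k).obj.map hV.fromSpec.op y ∈ (chartSubsheaf M k x).obj (op (Spec Γ(T, V))) := by
    rw [map_mem_chartSubsheaf_iff, IsAffineOpen.range_fromSpec]
    exact h
  rw [mem_chartSubsheaf_Spec_iff] at h1
  rwa [evalAffine_def]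

/-- Conversely, if `evalAffine V y ∈ chart x` then `V ≤ chartLocus x y`. [cite: GortzWedhorn2020, (8.4), Lemma 8.13 (p. 215)] -/
theorem le_chartLocus_of_evalAffine_mem_chart (x : Fin k → M) {T : Scheme.{u}} (y : (grassmannianSheaf M k).obj.obj (op T))
    {V : T.Opens} (hV : IsAffineOpen V) (h : evalAffine hV y ∈ chart ℤ M k x Γ(T, V)) : V ≤ chartLocus x y := by
  have h1 : (grassmannianSheaf M k).obj.map hV.fromSpec.op y ∈ (chartSubsheaf M k x).obj (op (Spec Γ(T, V))) := by
    rw [mem_chartSubsheaf_Spec_iff, ← evalAffine_def]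
    exact h
  rw [map_mem_chartSubsheaf_iff, IsAffineOpen.range_fromSpec] at h1
  exact h1

/-- `V ≤ chartLocus x y ↔ evalAffine V y ∈ chart x` for affine `V`. [cite: GortzWedhorn2020, (8.4), Lemma 8.13 (p. 215)] -/
theorem le_chartLocus_iff_evalAffine_mem_chart (x : Fin k → M) {T : Scheme.{u}} (y : (grassmannianSheaf M k).obj.obj (op T))
    {V : T.Opens} (hV : IsAffineOpen V) : V ≤ chartLocus x y ↔ evalAffine hV y ∈ chart ℤ M k x Γ(T, V) :=
  ⟨evalAffine_mem_chart_of_le_chartLocus x y hV, le_chartLocus_of_evalAffine_mem_chart x y hV⟩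

/-! ## §2 The universal chart data -/

section Universal

variable (k M) (b : Module.Basis J ℤ M) [(grassmannianSheaf M k).obj.IsRepresentable]

/-- The images `U_I` of the chart immersions are affine opens of the Grassmannian scheme. [cite: StacksProject, Tag 089T] -/
theorem isAffineOpen_opensRange_chartι (I : {I : Fin k → J // Function.Injective I}) :
    IsAffineOpen ((chartOpenCover k M b).f I).opensRange :=
  isAffineOpen_opensRange (X := chartScheme k I.1) _

/-- **The universal point restricted to the chart `U_I` lies in the chart of the frame `b ∘ I`.** [cite: StacksProject, Tag 089T]
[cite: GortzWedhorn2020, (8.4) (pp. 213–215)] -/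
theorem evalAffine_pointsEquiv_id_mem_chart (I : {I : Fin k → J // Function.Injective I}) :
    evalAffine (isAffineOpen_opensRange_chartι k M b I) (pointsEquiv M k _ (𝟙 (grassmannianScheme M k))) ∈
      chart ℤ M k (⇑b ∘ I.1) Γ(grassmannianScheme M k, ((chartOpenCover k M b).f I).opensRange) :=
  evalAffine_mem_chart_of_le_chartLocus _ _ _ (opensRange_chartι_eq k M b I).le

/-- **Every point of the Grassmannian scheme lies in some chart `U_I`** (★ `exists_mem_range_pointsEquiv_symm_chartElem`).
[cite: StacksProject, Tag 089T] -/
theorem exists_mem_opensRange_chartι (t : grassmannianScheme M k) :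
    ∃ I : {I : Fin k → J // Function.Injective I}, t ∈ ((chartOpenCover k M b).f I).opensRange := by
  obtain ⟨I, hI⟩ := exists_mem_range_pointsEquiv_symm_chartElem k M b t
  exact ⟨I, hI⟩

/-- **THE UNIVERSAL CHART DATA**: the standard affine open cover `U_I = im(Spec ℤ[X_I] ⟶ Gr)` of `grassmannianScheme M k`
(`I : Fin k → J` injective), with affine pairwise intersections (★ (B0) `isAffineOpen_opensRange_inf_opensRange`), frames `b ∘ I`,
and the universal point `x₀ = pointsEquiv (𝟙 Gr)` in the chart `b ∘ I` over `U_I` — B-p21's ★ `ChartData` at the universal point.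
[cite: GortzWedhorn2020, (8.4) (pp. 213–215)] [cite: StacksProject, Tag 089T] -/
def universalChartData :
    ChartData b (pointsEquiv M k _ (𝟙 (grassmannianScheme M k))) {I : Fin k → J // Function.Injective I} where
  U I := ((chartOpenCover k M b).f I).opensRange
  isAffineOpen I := isAffineOpen_opensRange_chartι k M b I
  isAffineOpen_inf I I' := isAffineOpen_opensRange_inf_opensRange k M b I' I
  frame I := I.1
  mem_chart I := evalAffine_pointsEquiv_id_mem_chart k M b I

/-- The opens of the universal chart data are the images of the chart immersions. [cite: StacksProject, Tag 089T] -/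
@[simp]
theorem universalChartData_U (I : {I : Fin k → J // Function.Injective I}) :
    (universalChartData k M b).U I = ((chartOpenCover k M b).f I).opensRange :=
  rfl

/-- The frames of the universal chart data are the `b ∘ I`. [cite: StacksProject, Tag 089T] -/
@[simp]
theorem universalChartData_frame (I : {I : Fin k → J // Function.Injective I}) : (universalChartData k M b).frame I = I.1 :=
  rfl

/-- **The universal chart data cover the Grassmannian scheme** (the `hcov` hypothesis of ★ `ChartData.hasRank_quotientModule` /
`ChartData.epi_quotientπ`). [cite: StacksProject, Tag 089T] -/
theorem exists_mem_universalChartData_U (t : grassmannianScheme M k) :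
    ∃ I : {I : Fin k → J // Function.Injective I}, t ∈ (universalChartData k M b).U I :=
  exists_mem_opensRange_chartι k M b t

/-! ## §3 THE UNIVERSAL QUOTIENT `𝒪_{Gr} ⊗ M ↠ 𝒬` -/

/-- **THE UNIVERSAL QUOTIENT `𝒬` ON THE GRASSMANNIAN SCHEME**: the rank-`k` module glued from the tautological chart quotients
along the transition cocycle (B-p21's ★ `ChartData.quotientModule` at the universal chart data).
[cite: GortzWedhorn2020, (8.4) (pp. 213–215)] [cite: StacksProject, Tag 089R] -/
abbrev universalQuotient : (grassmannianScheme M k).Modules :=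
  (universalChartData k M b).quotientModule

/-- **The universal sections `q_j ∈ Γ(𝒬, Gr)`**, images of `1 ⊗ b_j` (★ `ChartData.quotientSection`).
[cite: GortzWedhorn2020, (8.4) (pp. 213–215)] -/
abbrev universalQuotientSection (j : J) : Γ(universalQuotient k M b, ⊤) :=
  (universalChartData k M b).quotientSection j

/-- **The universal quotient map `π : 𝒪_{Gr}^{(J)} ⟶ 𝒬`, `ε_j ↦ q_j`** (★ `ChartData.quotientπ`).
[cite: GortzWedhorn2020, (8.4) (pp. 213–215)] -/
abbrev universalQuotientπ : freeModule (grassmannianScheme M k) J ⟶ universalQuotient k M b :=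
  (universalChartData k M b).quotientπ

/-- **The universal quotient has rank `k`.** [cite: GortzWedhorn2020, (8.4) (pp. 213–215)] -/
theorem hasRank_universalQuotient : HasRank (universalQuotient k M b) k :=
  (universalChartData k M b).hasRank_quotientModule (exists_mem_universalChartData_U k M b)

/-- **The universal quotient map `𝒪_{Gr}^{(J)} ⟶ 𝒬` is an epimorphism.** [cite: GortzWedhorn2020, (8.4) (pp. 213–215)] -/
theorem epi_universalQuotientπ : Epi (universalQuotientπ k M b) :=
  (universalChartData k M b).epi_quotientπ (exists_mem_universalChartData_U k M b)

/-- **The universal quotient is framed over each chart `U_I`** by the tautological frame `([1 ⊗ b_{I l}])_l` (★ `ChartData.quotientFrame`):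
the `𝒪`-module `𝒬|_{U_I} ≅ 𝒪^k`. [cite: GortzWedhorn2020, (8.4) (pp. 213–215)] -/
theorem nonempty_free_iso_universalQuotient_over (I : {I : Fin k → J // Function.Injective I}) :
    Nonempty (SheafOfModules.free (ULift.{u} (Fin k)) ≅ (universalQuotient k M b).over ((chartOpenCover k M b).f I).opensRange) :=
  ⟨(universalChartData k M b).quotientFrame I⟩

/-- **On an affine open `V ⊆ U_I` the kernel of the universal sections map `θ_V : Γ(Gr, V) ⊗ M → Γ(𝒬, V)` IS THE UNIVERSAL POINT
`x₀|_V`** (★ FILE B `ker_sectionsMap_eq_evalAffine` fed by ★ `ChartData.map_quotientSection_eq_sum`).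
[cite: GortzWedhorn2020, (8.4) (pp. 213–215)] [cite: StacksProject, Tag 089R] -/
theorem ker_sectionsMap_universalQuotientSection (I : {I : Fin k → J // Function.Injective I}) {V : (grassmannianScheme M k).Opens}
    (hV : IsAffineOpen V) (hVI : V ≤ ((chartOpenCover k M b).f I).opensRange) :
    LinearMap.ker (sectionsMap b (universalQuotient k M b) (universalQuotientSection k M b) V) =
      (evalAffine hV (pointsEquiv M k _ (𝟙 (grassmannianScheme M k)))).toSubmodule :=
  ker_sectionsMap_eq_evalAffine b _ _ Equiv.ulift ((universalChartData k M b).quotientFrame I) (homOfLE hVI) hV _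
    (⇑b ∘ I.1) ((universalChartData k M b).evalAffine_mem_chart hV hVI)
    (fun j => (universalChartData k M b).map_quotientSection_eq_sum j I hV hVI)

/-- On an affine open `V ⊆ U_I` the universal sections map `θ_V` is surjective (★ FILE B `sectionsMap_surjective_of_tautological`).
[cite: GortzWedhorn2020, (8.4) (pp. 213–215)] -/
theorem sectionsMap_universalQuotientSection_surjective (I : {I : Fin k → J // Function.Injective I})
    {V : (grassmannianScheme M k).Opens} (hV : IsAffineOpen V) (hVI : V ≤ ((chartOpenCover k M b).f I).opensRange) :
    Function.Surjective (sectionsMap b (universalQuotient k M b) (universalQuotientSection k M b) V) :=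
  sectionsMap_surjective_of_tautological b _ _ Equiv.ulift ((universalChartData k M b).quotientFrame I) (homOfLE hVI) hV _
    (⇑b ∘ I.1) ((universalChartData k M b).evalAffine_mem_chart hV hVI)
    (fun j => (universalChartData k M b).map_quotientSection_eq_sum j I hV hVI)

end Universal

end Literature.AlgebraicGeometry.Motives.Grassmannian

end
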